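import Summits.ABC.ABC.Theorems.IneffectiveSubspaceUniformSadicTowerFourStubOmegaCountedTwo
import Literature.NumberTheory.DiophantineGeometry.AbcWave0QualityFormProofs

/-!
# `UniformSadicTowerFour` (stmt-ABC-14937), line `flat-steep-split` (lead c3): the first open
# rung `W = 3` of BoundedOmegaABC is abc on three exponential shapes

Modulo the route's crux #6 the crux `UniformSadicTowerFour` is BoundedOmegaABC: abc with a
constant `C(W, ε)` on every cell `{ω(abc) ≤ W}` (`ω` = the number of distinct primes of `abc`).
The rung `W ≤ 2` is the theorem `MixedRadical.stub_omegaCounted_two`; the first OPEN rung is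
`W = 3`.  This file proves its STRUCTURE THEOREM `boundedOmegaAt_three_iff_shapes`: abc with
`C = C(ε)` on the cell `ω(abc) ≤ 3` (`B₃`) is EQUIVALENT to abc, with the bound
`c < C(ε) · (pqr)^(1+ε)`, on the three exponential shapes with prime bases `p, q, r` and exponents
`x, y, z ∈ ℕ`

* (A) `1 + p^x q^y = r^z` (`c = r^z`),
* (B) `1 + p^x = q^y r^z` (`c = q^y r^z`),
* (C) `p^x + q^y = r^z` with `p ≠ q` (`c = r^z`).

It certifies that the census of the cell `ω(abc) = 3` of the line (crux notes
`Cruxes/UniformSadicTowerFour/Census-omega3-c2.md`) enumerated a complete list of shapes, and it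
hands ideation three literature-matchable exponential Diophantine targets.

**Proof.** (→) For primes `p, q, r` the triples `(1, p^x q^y, r^z)`, `(1, p^x, q^y r^z)` and
`(p^x, q^y, r^z)` (coprime because `p ≠ q`) are abc triples whose product `p^x q^y r^z` has all
its prime factors among those of `pqr`; so `ω ≤ 3` and `rad ∣ pqr` (`Nat.radical_dvd_iff`),
whence `c < C · rad^(1+ε) ≤ C · (pqr)^(1+ε)` (`threePow_cell`, `bound_mono`).
(←) Take for `C` the sum of the four constants (cell `ω ≤ 2` and the three shapes).  An abc
triple is pairwise coprime, so `ω(abc) = ω(a) + ω(b) + ω(c)` with `ω(c) ≥ 1`.  If `ω(abc) = 3`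
and `a = 1` (or, symmetrically, `b = 1`), then `abc = n(n+1)` with `n ≥ 2` and
`(ω(n), ω(n+1)) ∈ {(2,1), (1,2)}`: by unique factorisation `n = p^x q^y`, `n + 1 = r^z` (shape A)
or `n = p^x`, `n + 1 = q^y r^z` (shape B) (`omegaThree_consecutive`).  If `a, b ≥ 2`, each of
`a, b, c` has exactly one prime factor: `a = p^x`, `b = q^y`, `c = r^z` with `p ≠ q` (shape C).
In every case the three primes are the three distinct primes of `abc`, so `pqr = rad(abc)`
EXACTLY (`omegaThree_shapes`), and the shape bound `c < C_• · (pqr)^(1+ε)` is the cell bound.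

Sources: the crux notes of the line (`Cruxes/UniformSadicTowerFour/`, census
`Census-omega3-c2.md`); the classification is elementary unique factorisation [folklore].
Mathlib only (`Nat.primeFactors_mul`, `Nat.Coprime.disjoint_primeFactors`,
`Nat.radical_eq_prod_primeFactors`, `Nat.radical_dvd_iff`,
`isPrimePow_iff_card_primeFactors_eq_one`, `Nat.prod_factorization_pow_eq_self`,
`Finset.card_eq_two`, `Real.rpow_le_rpow`) and `MixedRadical.stub_omegaCounted_two`.  No new
definitions.  Deliberately NOT here: the rung `W = 3` itself (OPEN: abc on each of the three
shapes is an open exponential Diophantine problem at exponent `1 + ε`), the other stubs of the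
line, and the kill paths of this namespace (another file).
-/
noncomputable section

-- `Summit.<Summit>.<Problem>` is the mandated summit-side namespace (CONVENTIONS §2); for the
-- single-conjunct summit `ABC` the two coincide, so the duplicate `ABC.ABC` is deliberate.
set_option linter.dupNamespace false

namespace Summit.ABC.ABC.Theorems.UniformSadicTowerFour.BoundedOmega

open Literature.NumberTheory.DiophantineGeometry (IsABCTriple rad rad_def)
open Summit.ABC.ABC.Theorems.UniformSadicTowerFour.MixedRadical (stub_omegaCounted_two)
open scoped BigOperators
open UniqueFactorizationMonoid (radical)

/-! ## Products of three prime powers: `ω ≤ 3` and `rad ≤ pqr` -/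

/-- For primes `p, q, r` the prime factors of `p^x q^y r^z` are among those of `pqr`; hence
`ω(p^x q^y r^z) ≤ 3` and `rad(p^x q^y r^z) ≤ pqr` (the radical divides `pqr`). [folklore] -/
private theorem threePow_cell {p q r : ℕ} (hp : p.Prime) (hq : q.Prime) (hr : r.Prime)
    (x y z : ℕ) :
    (p ^ x * q ^ y * r ^ z).primeFactors.card ≤ 3 ∧
      radical (p ^ x * q ^ y * r ^ z) ≤ p * q * r := by
  have h0 : p * q * r ≠ 0 := mul_ne_zero (mul_ne_zero hp.ne_zero hq.ne_zero) hr.ne_zero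
  have hsub : (p ^ x * q ^ y * r ^ z).primeFactors ⊆ (p * q * r).primeFactors := by
    intro s hs
    obtain ⟨hs', hdvd, -⟩ := Nat.mem_primeFactors.1 hs
    refine Nat.mem_primeFactors.2 ⟨hs', ?_, h0⟩
    rcases (Nat.Prime.dvd_mul hs').1 hdvd with h | h
    · rcases (Nat.Prime.dvd_mul hs').1 h with h | h
      · exact dvd_mul_of_dvd_left (dvd_mul_of_dvd_left (hs'.dvd_of_dvd_pow h) q) r
      · exact dvd_mul_of_dvd_left (dvd_mul_of_dvd_right (hs'.dvd_of_dvd_pow h) p) r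
    · exact dvd_mul_of_dvd_right (hs'.dvd_of_dvd_pow h) (p * q)
  have hpf : (p * q * r).primeFactors = {p, q, r} := by
    rw [Nat.primeFactors_mul (mul_ne_zero hp.ne_zero hq.ne_zero) hr.ne_zero,
      Nat.primeFactors_mul hp.ne_zero hq.ne_zero, hp.primeFactors, hq.primeFactors, hr.primeFactors]
    ext s
    simp only [Finset.mem_union, Finset.mem_insert, Finset.mem_singleton, or_assoc]
  refine ⟨(Finset.card_le_card hsub).trans ?_,
    Nat.le_of_dvd (Nat.pos_of_ne_zero h0) ((Nat.radical_dvd_iff h0).2 hsub)⟩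
  rw [hpf]
  exact Finset.card_le_three

/-- Monotonicity of the abc bound `C · R^(1+ε)` in the constant and in the radical slot: from
`c < C · m^(1+ε)`, `m ≤ R` and `C ≤ C'` follows `c < C' · R^(1+ε)`. [folklore] -/
private theorem bound_mono {c m R : ℕ} {C C' ε : ℝ} (hε : 0 < ε) (hC : 0 < C) (hCC : C ≤ C')
    (hmR : m ≤ R) (h : (c : ℝ) < C * (m : ℝ) ^ (1 + ε)) : (c : ℝ) < C' * (R : ℝ) ^ (1 + ε) :=
  h.trans_le (mul_le_mul hCC
    (Real.rpow_le_rpow (Nat.cast_nonneg _) (Nat.cast_le.2 hmR) (by linarith))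
    (Real.rpow_nonneg (Nat.cast_nonneg _) _) (hC.le.trans hCC))

/-! ## Classification of the cell `ω(abc) = 3` -/

/-- A positive number with exactly two prime factors `p ≠ q` is `p^x q^y` (unique factorisation).
[folklore] -/
private theorem eq_pow_mul_pow_of_card_eq_two {n : ℕ} (hn : n ≠ 0) (h : n.primeFactors.card = 2) :
    ∃ p q x y : ℕ, p.Prime ∧ q.Prime ∧ p ≠ q ∧ n.primeFactors = {p, q} ∧ n = p ^ x * q ^ y := by
  obtain ⟨p, q, hpq, hpf⟩ := Finset.card_eq_two.1 h
  have hp : p ∈ n.primeFactors := by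
    rw [hpf]
    exact Finset.mem_insert_self p {q}
  have hq : q ∈ n.primeFactors := by
    rw [hpf]
    exact Finset.mem_insert_of_mem (Finset.mem_singleton_self q)
  refine ⟨p, q, n.factorization p, n.factorization q, Nat.prime_of_mem_primeFactors hp,
    Nat.prime_of_mem_primeFactors hq, hpq, hpf, ?_⟩
  conv_lhs => rw [← Nat.prod_factorization_pow_eq_self hn]
  rw [Finsupp.prod, Nat.support_factorization, hpf, Finset.prod_pair hpq]

/-- **The cell `ω(n(n+1)) = 3`, `n ≥ 1`.** Then `n ≥ 2` and, with `p, q, r` the three (distinct)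
primes of `n(n+1)` — so that `pqr = rad(n(n+1))` — either `n = p^x q^y`, `n + 1 = r^z` (shape A) or
`n = p^x`, `n + 1 = q^y r^z` (shape B). [folklore] -/
theorem omegaThree_consecutive {n : ℕ} (hn : 0 < n)
    (hcard : (n * (n + 1)).primeFactors.card = 3) :
    ∃ p q r x y z : ℕ, p.Prime ∧ q.Prime ∧ r.Prime ∧ p * q * r ≤ radical (n * (n + 1)) ∧
      ((1 + p ^ x * q ^ y = r ^ z ∧ n + 1 = r ^ z) ∨
        (1 + p ^ x = q ^ y * r ^ z ∧ n + 1 = q ^ y * r ^ z)) := by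
  rcases Nat.lt_or_ge 1 n with hn1 | hn1
  swap
  · exfalso
    obtain rfl : n = 1 := le_antisymm hn1 hn
    rw [show (1 * (1 + 1) : ℕ) = 2 from rfl, Nat.prime_two.primeFactors,
      Finset.card_singleton] at hcard
    omega
  have hn0 : n ≠ 0 := by omega
  have hcop : Nat.Coprime n (n + 1) := Nat.coprime_self_add_right.2 (Nat.coprime_one_right n)
  have hU : (n * (n + 1)).primeFactors = n.primeFactors ∪ (n + 1).primeFactors :=
    Nat.primeFactors_mul hn0 n.succ_ne_zero
  have hD : Disjoint n.primeFactors (n + 1).primeFactors := hcop.disjoint_primeFactors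
  have hrad : radical (n * (n + 1)) =
      (∏ s ∈ n.primeFactors, s) * ∏ s ∈ (n + 1).primeFactors, s := by
    rw [Nat.radical_eq_prod_primeFactors, hU, Finset.prod_union hD]
  rw [hU, Finset.card_union_of_disjoint hD] at hcard
  have hc1 : 0 < n.primeFactors.card := Finset.card_pos.2 (Nat.nonempty_primeFactors.2 hn1)
  have hc2 : 0 < (n + 1).primeFactors.card :=
    Finset.card_pos.2 (Nat.nonempty_primeFactors.2 (by omega))
  rcases Nat.lt_or_ge 1 n.primeFactors.card with h2 | h1
  · -- shape A: `ω(n) = 2`, `ω(n + 1) = 1`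
    obtain ⟨p, q, x, y, hp, hq, hpq, hpf, hnpq⟩ := eq_pow_mul_pow_of_card_eq_two hn0 (by omega)
    obtain ⟨r, z, hr, hz, hrz⟩ := (isPrimePow_nat_iff _).1
      (isPrimePow_iff_card_primeFactors_eq_one.2 (by omega : (n + 1).primeFactors.card = 1))
    refine ⟨p, q, r, x, y, z, hp, hq, hr, le_of_eq ?_, Or.inl ⟨?_, hrz.symm⟩⟩
    · rw [hrad, hpf, Finset.prod_pair hpq, ← hrz, Nat.primeFactors_prime_pow hz.ne' hr,
        Finset.prod_singleton]
    · rw [← hnpq, Nat.add_comm]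
      exact hrz.symm
  · -- shape B: `ω(n) = 1`, `ω(n + 1) = 2`
    obtain ⟨p, x, hp, hx, hpx⟩ := (isPrimePow_nat_iff _).1
      (isPrimePow_iff_card_primeFactors_eq_one.2 (by omega : n.primeFactors.card = 1))
    obtain ⟨q, r, y, z, hq, hr, hqr, hpf, hnqr⟩ :=
      eq_pow_mul_pow_of_card_eq_two n.add_one_ne_zero (by omega)
    refine ⟨p, q, r, x, y, z, hp, hq, hr, le_of_eq ?_, Or.inr ⟨?_, hnqr⟩⟩
    · rw [hrad, hpf, Finset.prod_pair hqr, ← hpx, Nat.primeFactors_prime_pow hx.ne' hp,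
        Finset.prod_singleton, mul_assoc]
    · rw [hpx, Nat.add_comm]
      exact hnqr

/-- **Shape trichotomy of the cell `ω(abc) = 3`.** An abc triple with exactly three primes in
`abc` is, with `p, q, r` its three distinct primes (so that `pqr ≤ rad(abc)`, in fact `=`):
`(1, p^x q^y, r^z)` (shape A) or `(1, p^x, q^y r^z)` (shape B) — up to the order of the two
summands — or `(p^x, q^y, r^z)` with `p ≠ q` (shape C: two coprime summands `≥ 2` and their sum
carry one prime each). [folklore] -/
theorem omegaThree_shapes {a b c : ℕ} (h : IsABCTriple a b c)
    (hcard : (a * b * c).primeFactors.card = 3) :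
    ∃ p q r x y z : ℕ, p.Prime ∧ q.Prime ∧ r.Prime ∧ p * q * r ≤ rad a b c ∧
      ((1 + p ^ x * q ^ y = r ^ z ∧ c = r ^ z) ∨ (1 + p ^ x = q ^ y * r ^ z ∧ c = q ^ y * r ^ z) ∨
        (p ≠ q ∧ p ^ x + q ^ y = r ^ z ∧ c = r ^ z)) := by
  obtain ⟨ha, hb, hsum, hcop⟩ := h
  rw [rad_def]
  rcases Nat.lt_or_ge 1 a with ha1 | ha1
  · rcases Nat.lt_or_ge 1 b with hb1 | hb1
    · -- balanced, `a, b ≥ 2`: `a, b, c` are powers of three distinct primes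
      have hc0 : c ≠ 0 := by omega
      have hac : Nat.Coprime a c := by
        rw [← hsum]
        exact Nat.coprime_self_add_right.mpr hcop
      have hbc : Nat.Coprime b c := by
        rw [← hsum]
        exact Nat.coprime_add_self_right.mpr hcop.symm
      have hU1 : (a * b * c).primeFactors = (a * b).primeFactors ∪ c.primeFactors :=
        Nat.primeFactors_mul (mul_ne_zero ha.ne' hb.ne') hc0
      have hD1 : Disjoint (a * b).primeFactors c.primeFactors :=
        (Nat.Coprime.mul_left hac hbc).disjoint_primeFactors
      have hU2 : (a * b).primeFactors = a.primeFactors ∪ b.primeFactors :=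
        Nat.primeFactors_mul ha.ne' hb.ne'
      have hD2 : Disjoint a.primeFactors b.primeFactors := hcop.disjoint_primeFactors
      have hrad : radical (a * b * c) =
          (∏ s ∈ a.primeFactors, s) * (∏ s ∈ b.primeFactors, s) * ∏ s ∈ c.primeFactors, s := by
        rw [Nat.radical_eq_prod_primeFactors, hU1, Finset.prod_union hD1, hU2,
          Finset.prod_union hD2]
      rw [hU1, Finset.card_union_of_disjoint hD1, hU2, Finset.card_union_of_disjoint hD2] at hcard
      have h1 : 0 < a.primeFactors.card := Finset.card_pos.2 (Nat.nonempty_primeFactors.2 ha1)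
      have h2 : 0 < b.primeFactors.card := Finset.card_pos.2 (Nat.nonempty_primeFactors.2 hb1)
      have h3 : 0 < c.primeFactors.card :=
        Finset.card_pos.2 (Nat.nonempty_primeFactors.2 (by omega))
      obtain ⟨p, x, hp, hx, rfl⟩ :=
        (isPrimePow_nat_iff a).1 (isPrimePow_iff_card_primeFactors_eq_one.2 (by omega))
      obtain ⟨q, y, hq, hy, rfl⟩ :=
        (isPrimePow_nat_iff b).1 (isPrimePow_iff_card_primeFactors_eq_one.2 (by omega))
      obtain ⟨r, z, hr, hz, rfl⟩ :=
        (isPrimePow_nat_iff c).1 (isPrimePow_iff_card_primeFactors_eq_one.2 (by omega))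
      have hpq : p ≠ q := by
        rintro rfl
        rw [Nat.coprime_pow_left_iff hx, Nat.coprime_pow_right_iff hy, Nat.coprime_self] at hcop
        exact hp.one_lt.ne' hcop
      refine ⟨p, q, r, x, y, z, hp, hq, hr, le_of_eq ?_, Or.inr (Or.inr ⟨hpq, hsum, rfl⟩)⟩
      rw [hrad, Nat.primeFactors_prime_pow hx.ne' hp, Nat.primeFactors_prime_pow hy.ne' hq,
        Nat.primeFactors_prime_pow hz.ne' hr, Finset.prod_singleton, Finset.prod_singleton,
        Finset.prod_singleton]
    · -- `b = 1`: `abc = a(a+1)`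
      obtain rfl : b = 1 := le_antisymm hb1 hb
      subst hsum
      rw [mul_one] at hcard ⊢
      obtain ⟨p, q, r, x, y, z, hp, hq, hr, hle, hsh⟩ := omegaThree_consecutive ha hcard
      exact ⟨p, q, r, x, y, z, hp, hq, hr, hle, hsh.elim Or.inl fun h => Or.inr (Or.inl h)⟩
  · -- `a = 1`: `abc = b(b+1)`
    obtain rfl : a = 1 := le_antisymm ha1 ha
    subst hsum
    rw [one_mul, Nat.add_comm 1 b] at hcard ⊢
    obtain ⟨p, q, r, x, y, z, hp, hq, hr, hle, hsh⟩ := omegaThree_consecutive hb hcard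
    exact ⟨p, q, r, x, y, z, hp, hq, hr, hle, hsh.elim Or.inl fun h => Or.inr (Or.inl h)⟩

/-! ## The stub: `B₃ ⟺ shape A ∧ shape B ∧ shape C` -/

/-- **boundedOmegaAt_three_iff_shapes (structure theorem of the first open rung `W = 3` of
BoundedOmegaABC).** abc with `C = C(ε)` on the cell `ω(abc) ≤ 3` holds iff abc with the bound
`c < C(ε) · (pqr)^(1+ε)` holds on each of the three exponential shapes with prime bases `p, q, r`:
(A) `1 + p^x q^y = r^z`, (B) `1 + p^x = q^y r^z`, (C) `p^x + q^y = r^z` with `p ≠ q`.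
(→) The shapes are abc triples with `ω ≤ 3` and `rad ≤ pqr` (`threePow_cell`).  (←) The cell
`ω ≤ 2` is `MixedRadical.stub_omegaCounted_two`, and a triple with `ω(abc) = 3` is one of the three
shapes with `pqr = rad(abc)` (`omegaThree_shapes`); the constant is the sum of the four constants.
[folklore] -/
theorem boundedOmegaAt_three_iff_shapes :
    (∀ ε : ℝ, 0 < ε → ∃ C : ℝ, 0 < C ∧ ∀ a b c : ℕ, IsABCTriple a b c →
      (a * b * c).primeFactors.card ≤ 3 → (c : ℝ) < C * ((rad a b c : ℕ) : ℝ) ^ (1 + ε)) ↔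
    ((∀ ε : ℝ, 0 < ε → ∃ C : ℝ, 0 < C ∧ ∀ p q r x y z : ℕ, p.Prime → q.Prime → r.Prime →
        1 + p ^ x * q ^ y = r ^ z → ((r ^ z : ℕ) : ℝ) < C * ((p * q * r : ℕ) : ℝ) ^ (1 + ε)) ∧
      (∀ ε : ℝ, 0 < ε → ∃ C : ℝ, 0 < C ∧ ∀ p q r x y z : ℕ, p.Prime → q.Prime → r.Prime →
        1 + p ^ x = q ^ y * r ^ z →
          ((q ^ y * r ^ z : ℕ) : ℝ) < C * ((p * q * r : ℕ) : ℝ) ^ (1 + ε)) ∧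
      (∀ ε : ℝ, 0 < ε → ∃ C : ℝ, 0 < C ∧ ∀ p q r x y z : ℕ, p.Prime → q.Prime → r.Prime →
        p ≠ q → p ^ x + q ^ y = r ^ z →
          ((r ^ z : ℕ) : ℝ) < C * ((p * q * r : ℕ) : ℝ) ^ (1 + ε))) := by
  constructor
  · intro H
    refine ⟨fun ε hε => ?_, fun ε hε => ?_, fun ε hε => ?_⟩
    · -- shape A: the triple `(1, p^x q^y, r^z)`
      obtain ⟨C, hC, H⟩ := H ε hε
      refine ⟨C, hC, fun p q r x y z hp hq hr hE => ?_⟩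
      obtain ⟨hω, hR⟩ := threePow_cell hp hq hr x y z
      have ht : IsABCTriple 1 (p ^ x * q ^ y) (r ^ z) :=
        ⟨one_pos, mul_pos (pow_pos hp.pos x) (pow_pos hq.pos y), hE, Nat.coprime_one_left _⟩
      have hlt := H 1 (p ^ x * q ^ y) (r ^ z) ht (by rwa [one_mul])
      exact bound_mono hε hC le_rfl (by rwa [rad_def, one_mul]) hlt
    · -- shape B: the triple `(1, p^x, q^y r^z)`
      obtain ⟨C, hC, H⟩ := H ε hε
      refine ⟨C, hC, fun p q r x y z hp hq hr hE => ?_⟩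
      obtain ⟨hω, hR⟩ := threePow_cell hp hq hr x y z
      have ht : IsABCTriple 1 (p ^ x) (q ^ y * r ^ z) :=
        ⟨one_pos, pow_pos hp.pos x, hE, Nat.coprime_one_left _⟩
      have hlt := H 1 (p ^ x) (q ^ y * r ^ z) ht (by rwa [one_mul, ← mul_assoc])
      exact bound_mono hε hC le_rfl (by rwa [rad_def, one_mul, ← mul_assoc]) hlt
    · -- shape C: the triple `(p^x, q^y, r^z)`, coprime since `p ≠ q`
      obtain ⟨C, hC, H⟩ := H ε hε
      refine ⟨C, hC, fun p q r x y z hp hq hr hpq hE => ?_⟩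
      obtain ⟨hω, hR⟩ := threePow_cell hp hq hr x y z
      have ht : IsABCTriple (p ^ x) (q ^ y) (r ^ z) :=
        ⟨pow_pos hp.pos x, pow_pos hq.pos y, hE,
          Nat.Coprime.pow x y ((Nat.coprime_primes hp hq).2 hpq)⟩
      have hlt := H (p ^ x) (q ^ y) (r ^ z) ht hω
      exact bound_mono hε hC le_rfl (by rwa [rad_def]) hlt
  · rintro ⟨hA, hB, hC⟩ ε hε
    obtain ⟨C₂, hC₂, h₂⟩ := stub_omegaCounted_two ε hε
    obtain ⟨CA, hCA, hA⟩ := hA ε hε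
    obtain ⟨CB, hCB, hB⟩ := hB ε hε
    obtain ⟨CC, hCC, hC⟩ := hC ε hε
    refine ⟨C₂ + CA + CB + CC, by linarith, fun a b c habc hcard => ?_⟩
    rcases hcard.lt_or_eq with hlt | h3
    · -- the cell `ω(abc) ≤ 2`
      exact bound_mono hε hC₂ (by linarith) le_rfl (h₂ a b c habc (by omega))
    -- the cell `ω(abc) = 3`: one of the three shapes, with `pqr = rad(abc)`
    obtain ⟨p, q, r, x, y, z, hp, hq, hr, hle, hsh⟩ := omegaThree_shapes habc h3
    rcases hsh with ⟨hE, rfl⟩ | ⟨hE, rfl⟩ | ⟨hpq, hE, rfl⟩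
    · exact bound_mono hε hCA (by linarith) hle (hA p q r x y z hp hq hr hE)
    · exact bound_mono hε hCB (by linarith) hle (hB p q r x y z hp hq hr hE)
    · exact bound_mono hε hCC (by linarith) hle (hC p q r x y z hp hq hr hpq hE)

end Summit.ABC.ABC.Theorems.UniformSadicTowerFour.BoundedOmega

end
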